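import Summits.Ventures.LatticeQCDFlow.Scoring.OneStepMethodConvergence
import Summits.Ventures.LatticeQCDFlow.Scoring.WilsonFlowRK3LocalError
import Summits.Ventures.LatticeQCDFlow.Scaling.FlowLipschitzBudget
import HarnessLib

/-!
# The engine's RK3 integrator CONVERGES to Lüscher's Wilson flow: `RK3_{t/m}^m V → wilsonFlow t V` uniformly in the configuration, and the measured flowed charge and energy converge with it

HONEST FRAMING: exact (Metropolis-corrected) sampling algorithms for lattice gauge theory;
figures of merit are autocorrelation/cost numbers at stated couplings and volumes; no
continuum-physics claim.

Venture `LatticeQCDFlow` (cell pub-lqcd), sub-topic `Scoring`; FANOUT row 16 (`su2-base`: `τ_int(Q)` with `Q`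
the clover charge measured AFTER WILSON FLOW, and `τ_int(t²E)`, both computed on the field flowed by `m = t/ε`
steps of the engine's `lc_flow_rk3_step` = gen-4's `wilsonFlowRK3 ε`).  NEW WORK of the cell (placement rule);
third file of the RK3-CONVERGENCE packet, the INSTANCE of the abstract Lax theorem
`Scoring/OneStepMethodConvergence.oneStep_tendstoUniformlyOn_iterate` with the uniform consistency of
`Scoring/WilsonFlowRK3LocalError.rk3_uniform_consistency`, over the Literature's Wilson flow
(`QuantumFieldTheory/WilsonFlow`: `wilsonFlow`, `wilsonFlow_zero`, `wilsonFlow_add`, the ambient ODE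
`hasDerivAt_coeConfig_of_isWilsonFlowLine`, the Lipschitz bound `exists_lipschitzOnWith_vfAmb` on the ball
`closedBall 0 ρ₀ ⊇ SU(n)^E`) and Mathlib's Grönwall inequality for two exact trajectories
(`dist_le_of_trajectories_ODE_of_mem`); the isometry `SU(n)^E ↪ M_n(ℂ)^E` is row 30's
`Scaling/FlowLipschitzBudget.dist_coeConfig` (whose `lipschitzWith_flowMap_one` is the unit-time Grönwall bound for
abstract flow maps; here the bound is needed at every time `s ≥ 0` for the concrete `wilsonFlow`).  Nothing is cited
as a fact; no number.  Printed counterpart, NAMED ONLY: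
Lüscher, JHEP 08 (2010) 071, App. C (the scheme; its convergence is taken for granted there);
Hairer–Nørsett–Wanner I §II.3 (convergence of one-step methods).

`Scoring/WilsonFlowRK3Consistency` (gen-4) listed "global convergence `RK3_{t/m}^m → wilsonFlow t`" as NOT
CLAIMED.  It is claimed and proved here, for every `d`, `n`, `L ≥ 1`, every flow time `t ≥ 0`, uniformly in the
configuration.

## What is here

* §1 the configuration space `SU(n)^E` carries the metric it inherits from the ambient matrix space (sup over
  links of the Frobenius distance); `coeConfig` is an isometry — REUSED from row 30's
  `Scaling/FlowLipschitzBudget` (`Theory2.Lattice.SUN.dist_coeConfig`), bundled here as `isometry_coeConfig`.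
* §2 **`wilsonFlow_dist_le`** — LIPSCHITZ STABILITY of the exact flow: there is `K ≥ 0` with
  `dist (wilsonFlow s U) (wilsonFlow s U') ≤ e^{K s} dist U U'` for all `s ≥ 0` and all `U, U'` (Grönwall).
* §3 **`tendstoUniformly_iterate_wilsonFlowRK3`** — for every `t > 0`, `(RK3_{t/m})^[m] → wilsonFlow t`
  UNIFORMLY on `SU(n)^E` as `m → ∞`; **`tendsto_iterate_wilsonFlowRK3`** — pointwise, for every `t ≥ 0` and
  every `V`: the field the engine produces by refining the step at fixed flow time converges to the exactly
  flowed field.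
* §4 consequences for what row 16 records (`d = 4`, fundamental `SU(n)`, `L ≥ 1`): every continuous observable
  of the RK3-flowed field converges uniformly to the same observable of the exactly flowed field
  (`tendstoUniformly_comp_iterate_wilsonFlowRK3`), in particular the flowed clover charge
  `Σ_x P_x(RK3_{t/m}^m U) → Σ_x P_x(wilsonFlow t U)` (`tendsto_rk3CloverCharge`,
  `tendstoUniformly_rk3CloverCharge`) and the flowed clover energy at every site (`tendsto_rk3CloverEnergy`);
  and their MEANS under ANY finite measure on configurations — the Wilson measure `μ_{Λ,β}`, or the law of a
  sampler's chain at any step — converge (`tendsto_integral_comp_iterate_wilsonFlowRK3`,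
  `tendsto_integral_rk3CloverCharge`): the step-size systematic of the recorded flowed observables vanishes in
  the limit, configuration by configuration and in expectation.

NOT CLAIMED: a RATE (the printed third order; only qualitative convergence is proved — the local error is
controlled as `o(ε)`, `WilsonFlowRK3LocalError`); negative flow times (same proof, not needed); adaptive step
sizes; anything about `τ_int`; floating point; any number.
-/

namespace Summit.Ventures.LatticeQCDFlow.Scoring

open Matrix Filter Topology Set MeasureTheory Literature.MathematicalPhysics.QuantumFieldTheory
open Literature.MathematicalPhysics.QuantumFieldTheory.Luscher2010 (AmbConfig)
open Literature.MathematicalPhysics.QuantumLattice (fundamentalRep continuous_fundamentalRep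
  cloverPseudoscalar continuous_cloverPseudoscalar flowedCloverEnergy continuous_flowedCloverEnergy_zero)
open Summit.Ventures.LatticeQCDFlow.Theory2.Lattice.SUN (dist_coeConfig)

open scoped Matrix.Norms.Frobenius NNReal

-- The scoped Frobenius instances are definitionally the product structures, but only at default transparency
-- (as in Mathlib's `MatrixExponential` and `Scoring/WilsonFlowRK3Consistency`).
set_option backward.isDefEq.respectTransparency false

variable {d L n : ℕ}

/-! ## §1 The metric on the configuration space -/

section MetricSpace

variable [NeZero L]

/-- `coeConfig : SU(n)^E → M_n(ℂ)^E` is an isometry (bundled form of row 30's `Theory2.Lattice.SUN.dist_coeConfig`: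
the distance of two configurations — sup over links of the Frobenius distance — is that of their images). -/
theorem isometry_coeConfig : Isometry (WilsonFlow.coeConfig (d := d) (L := L) (n := n)) :=
  Isometry.of_dist_eq fun U U' => dist_coeConfig U U'

end MetricSpace

/-! ## §2 Lipschitz stability of the exact flow (Grönwall) -/

section Stability

variable [NeZero L]

/-- **Lipschitz stability of the Wilson flow.**  There is a rate `K ≥ 0` (a Lipschitz constant of the flow
vector field on the ball containing `SU(n)^E`) such that for all `s ≥ 0` and all configurations `U, U'`,
`dist (wilsonFlow s U) (wilsonFlow s U') ≤ e^{K s} · dist U U'` — two exact flow lines separate at most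
exponentially (Grönwall, `dist_le_of_trajectories_ODE_of_mem`). -/
theorem wilsonFlow_dist_le :
    ∃ K : ℝ≥0, ∀ s : ℝ, 0 ≤ s → ∀ U U' : GaugeConfig d L (Matrix.specialUnitaryGroup (Fin n) ℂ),
      dist (wilsonFlow s U) (wilsonFlow s U') ≤ Real.exp (K * s) * dist U U' := by
  obtain ⟨K, hK⟩ := WilsonFlow.exists_lipschitzOnWith_vfAmb (d := d) (L := L) (n := n)
  refine ⟨K, fun s hs U U' => ?_⟩
  have hf := fun t => WilsonFlow.hasDerivAt_coeConfig_of_isWilsonFlowLine (isWilsonFlowLine_wilsonFlow U) t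
  have hg := fun t => WilsonFlow.hasDerivAt_coeConfig_of_isWilsonFlowLine (isWilsonFlowLine_wilsonFlow U') t
  have key := dist_le_of_trajectories_ODE_of_mem (v := fun _ => WilsonFlow.vfAmb)
    (s := fun _ => Metric.closedBall (0 : AmbConfig d L n) (WilsonFlow.ρ₀ d L n)) (K := K)
    (f := fun t => WilsonFlow.coeConfig (wilsonFlow t U)) (g := fun t => WilsonFlow.coeConfig (wilsonFlow t U'))
    (a := 0) (b := s) (δ := dist U U')
    (fun _ _ => hK)
    (fun t _ => (hf t).continuousAt.continuousWithinAt)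
    (fun t _ => (hf t).hasDerivWithinAt)
    (fun t _ => WilsonFlow.coeConfig_mem_closedBall _)
    (fun t _ => (hg t).continuousAt.continuousWithinAt)
    (fun t _ => (hg t).hasDerivWithinAt)
    (fun t _ => WilsonFlow.coeConfig_mem_closedBall _)
    (le_of_eq (by rw [wilsonFlow_zero, wilsonFlow_zero, dist_coeConfig]))
    s ⟨hs, le_rfl⟩
  rw [dist_coeConfig, sub_zero] at key
  calc dist (wilsonFlow s U) (wilsonFlow s U') ≤ dist U U' * Real.exp (K * s) := key
    _ = Real.exp (K * s) * dist U U' := mul_comm _ _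

end Stability

/-! ## §3 Convergence of the integrator -/

section Convergence

variable [NeZero L]

/-- **The engine's RK3 integrator converges to the Wilson flow, uniformly in the configuration.**  For every
flow time `t > 0`, the `m`-step RK3 approximation with step `t/m` converges to `wilsonFlow t` UNIFORMLY on the
whole configuration space `SU(n)^E` as `m → ∞` (every `d`, `n`, `L ≥ 1`).  Proof: the abstract Lax theorem
`oneStep_tendstoUniformlyOn_iterate` with `K = univ`, the semigroup law `wilsonFlow_add`, the Grönwall stability
`wilsonFlow_dist_le` and the uniform consistency `rk3_uniform_consistency_dist`. -/
theorem tendstoUniformly_iterate_wilsonFlowRK3 {t : ℝ} (ht : 0 < t) :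
    TendstoUniformly (fun m : ℕ => (wilsonFlowRK3 (d := d) (L := L) (n := n) (t / m))^[m]) (wilsonFlow t) atTop := by
  obtain ⟨K, hK⟩ := wilsonFlow_dist_le (d := d) (L := L) (n := n)
  rw [← tendstoUniformlyOn_univ]
  refine oneStep_tendstoUniformlyOn_iterate (K := univ) (φ := fun s => wilsonFlow s) (Φ := fun ε => wilsonFlowRK3 ε)
    (L := K) K.coe_nonneg (fun s _ => mapsTo_univ _ _) (fun ε _ => mapsTo_univ _ _)
    (fun x _ => by rw [wilsonFlow_zero]) (fun s t _ _ x _ => wilsonFlow_add s t x)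
    (fun s hs x _ y _ => hK s hs x y) (fun η hη => ?_) ht
  filter_upwards [rk3_uniform_consistency_dist (d := d) (L := L) (n := n) hη] with ε hε x _
  rw [← dist_coeConfig]
  exact hε x

/-- **Pointwise convergence**: for every flow time `t ≥ 0` and every configuration `V`,
`RK3_{t/m}^m V → wilsonFlow t V` as `m → ∞`. -/
theorem tendsto_iterate_wilsonFlowRK3 {t : ℝ} (ht : 0 ≤ t) (V : GaugeConfig d L (Matrix.specialUnitaryGroup (Fin n) ℂ)) :
    Tendsto (fun m : ℕ => (wilsonFlowRK3 (t / m))^[m] V) atTop (𝓝 (wilsonFlow t V)) := by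
  rcases eq_or_lt_of_le ht with h0 | hpos
  · -- `t = 0`: every term is `V`
    subst h0
    have hconst : (fun m : ℕ => (wilsonFlowRK3 (d := d) (L := L) (n := n) ((0 : ℝ) / m))^[m] V) = fun _ => V := by
      funext m
      rw [zero_div]
      exact Function.iterate_fixed (wilsonFlowRK3_zero V) m
    rw [hconst, wilsonFlow_zero]
    exact tendsto_const_nhds
  · exact (tendstoUniformly_iterate_wilsonFlowRK3 hpos).tendsto_at V

/-- Link by link, entry by entry: every matrix entry of the RK3-flowed link converges to the entry of the
exactly flowed link (the instance-free form). -/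
theorem tendsto_iterate_wilsonFlowRK3_apply {t : ℝ} (ht : 0 ≤ t)
    (V : GaugeConfig d L (Matrix.specialUnitaryGroup (Fin n) ℂ)) (e : Edge d L) (i j : Fin n) :
    Tendsto (fun m : ℕ => (((wilsonFlowRK3 (t / m))^[m] V e : Matrix.specialUnitaryGroup (Fin n) ℂ) :
        Matrix (Fin n) (Fin n) ℂ) i j) atTop
      (𝓝 (((wilsonFlow t V e : Matrix.specialUnitaryGroup (Fin n) ℂ) : Matrix (Fin n) (Fin n) ℂ) i j)) := by
  have h := tendsto_iterate_wilsonFlowRK3 ht V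
  have he : Tendsto (fun m : ℕ => (wilsonFlowRK3 (t / m))^[m] V e) atTop (𝓝 (wilsonFlow t V e)) :=
    (continuous_apply e).continuousAt.tendsto.comp h
  have hc : Continuous fun A : Matrix.specialUnitaryGroup (Fin n) ℂ => (A : Matrix (Fin n) (Fin n) ℂ) i j :=
    continuous_subtype_val.matrix_elem i j
  exact hc.continuousAt.tendsto.comp he

/-- **Every continuous observable of the RK3-flowed field converges, uniformly in the configuration, to the
same observable of the exactly flowed field** (`SU(n)^E` is compact, so a continuous observable is uniformly
continuous). -/
theorem tendstoUniformly_comp_iterate_wilsonFlowRK3 {Y : Type*} [UniformSpace Y]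
    {F : GaugeConfig d L (Matrix.specialUnitaryGroup (Fin n) ℂ) → Y} (hF : Continuous F) {t : ℝ} (ht : 0 < t) :
    TendstoUniformly (fun m : ℕ => F ∘ (wilsonFlowRK3 (t / m))^[m]) (F ∘ wilsonFlow t) atTop :=
  (CompactSpace.uniformContinuous_of_continuous hF).comp_tendstoUniformly
    (tendstoUniformly_iterate_wilsonFlowRK3 ht)

/-- Pointwise form for observables, every `t ≥ 0`. -/
theorem tendsto_comp_iterate_wilsonFlowRK3 {Y : Type*} [TopologicalSpace Y]
    {F : GaugeConfig d L (Matrix.specialUnitaryGroup (Fin n) ℂ) → Y} (hF : Continuous F) {t : ℝ} (ht : 0 ≤ t)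
    (V : GaugeConfig d L (Matrix.specialUnitaryGroup (Fin n) ℂ)) :
    Tendsto (fun m : ℕ => F ((wilsonFlowRK3 (t / m))^[m] V)) atTop (𝓝 (F (wilsonFlow t V))) :=
  hF.continuousAt.tendsto.comp (tendsto_iterate_wilsonFlowRK3 ht V)

/-- **Means converge under every finite measure.**  For every continuous real observable `F`, every finite
measure `μ` on configurations (the Wilson measure `μ_{Λ,β}`, the law of a Markov chain at any step, …) and every
`t ≥ 0`: `∫ F(RK3_{t/m}^m U) dμ → ∫ F(wilsonFlow t U) dμ` (dominated convergence; `F` is bounded on the compact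
configuration space). -/
theorem tendsto_integral_comp_iterate_wilsonFlowRK3
    {F : GaugeConfig d L (Matrix.specialUnitaryGroup (Fin n) ℂ) → ℝ} (hF : Continuous F)
    (μ : Measure (GaugeConfig d L (Matrix.specialUnitaryGroup (Fin n) ℂ))) [IsFiniteMeasure μ] {t : ℝ} (ht : 0 ≤ t) :
    Tendsto (fun m : ℕ => ∫ U, F ((wilsonFlowRK3 (t / m))^[m] U) ∂μ) atTop (𝓝 (∫ U, F (wilsonFlow t U) ∂μ)) := by
  -- a uniform bound for `F`
  obtain ⟨C, hC⟩ := (isCompact_range hF).isBounded.subset_closedBall (0 : ℝ)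
  have hbound : ∀ U, ‖F U‖ ≤ C := fun U => by
    have h := hC (mem_range_self U)
    rwa [Metric.mem_closedBall, dist_zero_right] at h
  refine tendsto_integral_of_dominated_convergence (fun _ => C) (fun m => ?_) (integrable_const C) (fun m => ?_) ?_
  · exact (hF.comp (continuous_iterate_wilsonFlowRK3 _ m)).measurable.aestronglyMeasurable
  · exact Eventually.of_forall fun U => hbound _
  · exact Eventually.of_forall fun U => tendsto_comp_iterate_wilsonFlowRK3 hF ht U

end Convergence

/-! ## §4 The observables row 16 records -/

section Observables

variable {L n : ℕ} [NeZero L]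

/-- **The measured flowed clover charge converges to the exactly flowed clover charge**: for every `t ≥ 0`
and every configuration `U` on `(ℤ/L)^4`, `Σ_x P_x(RK3_{t/m}^m U) → Σ_x P_x(wilsonFlow t U)` as `m → ∞`
(`SU(n)` in the fundamental representation; row 16: `n = 2`). -/
theorem tendsto_rk3CloverCharge {t : ℝ} (ht : 0 ≤ t) (U : GaugeConfig 4 L (Matrix.specialUnitaryGroup (Fin n) ℂ)) :
    Tendsto (fun m : ℕ => ∑ x : Site 4 L, cloverPseudoscalar (fundamentalRep (Fin n)) x ((wilsonFlowRK3 (t / m))^[m] U))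
      atTop (𝓝 (∑ x : Site 4 L, cloverPseudoscalar (fundamentalRep (Fin n)) x (wilsonFlow t U))) :=
  tendsto_comp_iterate_wilsonFlowRK3
    (F := fun V : GaugeConfig 4 L (Matrix.specialUnitaryGroup (Fin n) ℂ) =>
      ∑ x : Site 4 L, cloverPseudoscalar (fundamentalRep (Fin n)) x V)
    (continuous_finsetSum _ fun x _ =>
      continuous_cloverPseudoscalar (fundamentalRep (Fin n)) (continuous_fundamentalRep (Fin n)) x) ht U

/-- Uniform form: for `t > 0` the convergence of the measured flowed clover charge is UNIFORM over all
configurations. -/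
theorem tendstoUniformly_rk3CloverCharge {t : ℝ} (ht : 0 < t) :
    TendstoUniformly
      (fun (m : ℕ) (U : GaugeConfig 4 L (Matrix.specialUnitaryGroup (Fin n) ℂ)) =>
        ∑ x : Site 4 L, cloverPseudoscalar (fundamentalRep (Fin n)) x ((wilsonFlowRK3 (t / m))^[m] U))
      (fun U => ∑ x : Site 4 L, cloverPseudoscalar (fundamentalRep (Fin n)) x (wilsonFlow t U)) atTop :=
  tendstoUniformly_comp_iterate_wilsonFlowRK3
    (F := fun V : GaugeConfig 4 L (Matrix.specialUnitaryGroup (Fin n) ℂ) =>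
      ∑ x : Site 4 L, cloverPseudoscalar (fundamentalRep (Fin n)) x V)
    (continuous_finsetSum _ fun x _ =>
      continuous_cloverPseudoscalar (fundamentalRep (Fin n)) (continuous_fundamentalRep (Fin n)) x) ht

/-- **The measured flowed clover energy at every site converges to the exactly flowed one** (row 16's `t²E`):
`E_x(RK3_{t/m}^m U) → E_x(wilsonFlow t U)` for every `t ≥ 0`, `x`, `U`. -/
theorem tendsto_rk3CloverEnergy {t : ℝ} (ht : 0 ≤ t) (x : Site 4 L)
    (U : GaugeConfig 4 L (Matrix.specialUnitaryGroup (Fin n) ℂ)) :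
    Tendsto (fun m : ℕ => flowedCloverEnergy (fundamentalRep (Fin n)) 0 x ((wilsonFlowRK3 (t / m))^[m] U)) atTop
      (𝓝 (flowedCloverEnergy (fundamentalRep (Fin n)) 0 x (wilsonFlow t U))) :=
  tendsto_comp_iterate_wilsonFlowRK3
    (continuous_flowedCloverEnergy_zero (fundamentalRep (Fin n)) (continuous_fundamentalRep (Fin n)) x) ht U

/-- **The mean measured flowed charge converges to the mean exactly flowed charge** under every finite measure
on configurations (e.g. `μ_{Λ,β}`, under which both means are `0` by the `⟨Q⟩ = 0` packet — or the law of an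
HMC / heat-bath chain at any step), every `t ≥ 0`. -/
theorem tendsto_integral_rk3CloverCharge (μ : Measure (GaugeConfig 4 L (Matrix.specialUnitaryGroup (Fin n) ℂ)))
    [IsFiniteMeasure μ] {t : ℝ} (ht : 0 ≤ t) :
    Tendsto (fun m : ℕ => ∫ U, (∑ x : Site 4 L,
        cloverPseudoscalar (fundamentalRep (Fin n)) x ((wilsonFlowRK3 (t / m))^[m] U)) ∂μ) atTop
      (𝓝 (∫ U, (∑ x : Site 4 L, cloverPseudoscalar (fundamentalRep (Fin n)) x (wilsonFlow t U)) ∂μ)) :=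
  tendsto_integral_comp_iterate_wilsonFlowRK3
    (F := fun V : GaugeConfig 4 L (Matrix.specialUnitaryGroup (Fin n) ℂ) =>
      ∑ x : Site 4 L, cloverPseudoscalar (fundamentalRep (Fin n)) x V)
    (continuous_finsetSum _ fun x _ =>
      continuous_cloverPseudoscalar (fundamentalRep (Fin n)) (continuous_fundamentalRep (Fin n)) x) μ ht

/-- Likewise for the mean flowed clover energy at every site (row 16's `⟨t²E⟩`). -/
theorem tendsto_integral_rk3CloverEnergy (μ : Measure (GaugeConfig 4 L (Matrix.specialUnitaryGroup (Fin n) ℂ)))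
    [IsFiniteMeasure μ] {t : ℝ} (ht : 0 ≤ t) (x : Site 4 L) :
    Tendsto (fun m : ℕ => ∫ U, flowedCloverEnergy (fundamentalRep (Fin n)) 0 x ((wilsonFlowRK3 (t / m))^[m] U) ∂μ)
      atTop (𝓝 (∫ U, flowedCloverEnergy (fundamentalRep (Fin n)) 0 x (wilsonFlow t U) ∂μ)) :=
  tendsto_integral_comp_iterate_wilsonFlowRK3
    (continuous_flowedCloverEnergy_zero (fundamentalRep (Fin n)) (continuous_fundamentalRep (Fin n)) x) μ ht

end Observables

end Summit.Ventures.LatticeQCDFlow.Scoring
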